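import Literature.Probability.LatticeModels.CurrentExplorationWeights
import Literature.Probability.LatticeModels.RestrictedCorrelationMonotone
import HarnessLib

/-!
# The chain rule for backbones, one passage point: `P^{ab}[Γ passes through u] ≤ ⟨σ_aσ_u⟩⟨σ_uσ_b⟩/⟨σ_aσ_b⟩`

Topic `Literature/Probability/LatticeModels`. The backbone `Γ(n)` of a current with sources
`∂n = {a,b}` — the walk of Aizenman 1982, §9, realised in the tree by the deterministic exploration
`Current.explore rk n Y a` (`CurrentExploration.lean`: bonds examined in the order of an injective
ranking `rk`, target set `Y`) — obeys the **chain rule** of Aizenman–Barsky–Fernández 1987 (the form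
of Aizenman 1982, Prop. 9.2 / Lemma 9.2: conditioned on the walk up to its first visit of `u`, the rest
is a current of the model "with the interaction set to zero on the bonds `B(ω)`", whose two-point
function is dominated by the full one by Griffiths' inequality). It is invoked in

* M. Aizenman, H. Duminil-Copin, *Marginal triviality of the scaling limits of critical 4D Ising and
  `φ⁴₄` models*, Ann. of Math. **194** (2021), arXiv:1912.07973 [AizenmanDuminilCopinAnnals2021],
  proof of **Lemma 6.7**, display (6.11) (p. 25): "the chain rule for backbones [AizBarFer87] gives …
  `P^{xy}[Γ(n_i) crosses Ann(M,R)] ≤ ∑_{v ∈ ∂Λ_R} ⟨σ_{x_i}σ_v⟩⟨σ_vσ_{u_i}⟩/⟨σ_{x_i}σ_{u_i}⟩`", and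
  display (6.13): "`P^{xy}[Γ(n'_i) crosses Ann(r,m)] ≤ C₄ ∑_{v ∈ ∂Λ_r} ⟨σ_{u_i}σ_v⟩⟨σ_vσ_{y_i}⟩/⟨σ_{u_i}σ_{y_i}⟩`"
  (and, in its two-passage form, in the bounds on `F₁`, `F₄` of Lemma 4.4 / 6.2).

This file proves the **one-passage chain rule** in finite volume, for general couplings `K ≥ 0`
(un-normalised current-sum form), with the passage event read on the walk with the enlarged target
`Y' ⊇ {u}` — "the walk from `a` stops at `u`", which for the backbone (`Y = {b}`) means "`Γ` reaches
`u` before `b`" (`Current.pos_explore_union_mem_of_mem_vis` supplies the comparison with the visited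
set of the walk with the original target):

* `Current.tsum_backbonePass_mul_le` — for **every** target set `Y`, vertices `a b u`:
  `(∑ 1{∂n={a}Δ{b}} w(n) 𝟙[(explore rk n Y a).pos = u]) · Z[∅] ≤ Z[{a}Δ{u}] · Z[{u}Δ{b}]`,
  i.e. `P^{ab}[the Y-walk from a ends at u] ≤ ⟨σ_aσ_u⟩⟨σ_uσ_b⟩/⟨σ_aσ_b⟩`;
* `Current.tsum_backbonePass_mem_mul_le` — summed over a set `S` of passage points (the printed sums
  over `v ∈ ∂Λ_R`): `(∑ 1{∂n={a}Δ{b}} w(n) 𝟙[(explore rk n Y a).pos ∈ S]) · Z[∅] ≤ ∑_{u ∈ S} Z[{a}Δ{u}] Z[{u}Δ{b}]`;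
* `Current.pos_explore_union_mem_of_mem_vis` — **first passage**: if the walk with target `Y` visits a
  site of `S`, the walk with target `Y ∪ S` ends in `S`; hence (`Current.tsum_backboneVisits_mul_le`)
  `(∑ 1{∂n={a}Δ{b}} w(n) 𝟙[(explore rk n Y a).vis ∩ S ≠ ∅]) · Z[∅] ≤ ∑_{u ∈ S} Z[{a}Δ{u}] Z[{u}Δ{b}]` —
  the form "`P^{ab}[Γ visits S] ≤ ∑_{u ∈ S} ⟨σ_aσ_u⟩⟨σ_uσ_b⟩/⟨σ_aσ_b⟩`" of (6.11)/(6.13).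

Mechanism (as in Aizenman 1982, Prop. 9.2): partition `{(explore n).pos = u}` by the final state `δ`
of the walk; the walk determines its cylinder and conversely (`Current.explore_eq_iff_inCyl`, locality
`explore_congr`), so each part is a cylinder sum `patSum(δ) · Z_{K off used(δ)}[{a,b} Δ {a} Δ {u}] =
patSum(δ) · Z_off[{u} Δ {b}]` (`tsum_sources_inCyl_eq`), bounded by `patSum(δ) Z_off[∅] · Z[{u}Δ{b}]/Z[∅]`
(Griffiths' comparison `wcurrentSum_mul_le_of_le` for `K off D ≤ K`), and `∑_δ patSum(δ) Z_off[∅]` is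
the same cylinder decomposition of the currents with sources `{a} Δ {u}`, whose total is `≤ Z[{a}Δ{u}]`.
No named fact is introduced; everything is proved. The two-passage (ordered) chain rule needed for the
zigzag events `F₁`, `F₄` requires in addition a restart property of the walk and is not taken here.

## References

* M. Aizenman, H. Duminil-Copin, Ann. of Math. 194 (2021), arXiv:1912.07973, §6.2, proof of Lemma 6.7,
  (6.11), (6.13) (p. 25); §4.2, proof of Lemma 4.4 ("The chain rule for backbones (see e.g.
  [AizBarFer87])", p. 12) [AizenmanDuminilCopinAnnals2021].
* M. Aizenman, D. J. Barsky, R. Fernández, *The phase transition in a general class of Ising-type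
  models is sharp*, J. Stat. Phys. 47 (1987) 343–374 (the chain rule for backbones) — cited by the
  source; the finite-volume statement here is derived directly from Aizenman 1982, §9.
* M. Aizenman, Comm. Math. Phys. 86 (1982) 1–48, §9, Prop. 9.2, Lemma 9.2, Lemma 9.3 [AizenmanCMP1982]
  — through `CurrentExploration.lean`, `CurrentExplorationWeights.lean`.
-/

noncomputable section

open Finset
open scoped symmDiff ENNReal

namespace Literature.Probability.LatticeModels

variable {V : Type*} [Fintype V] [DecidableEq V] {G : SimpleGraph V} [DecidableRel G.Adj]

/-- **Griffiths' comparison inequality in `ℝ≥0∞`**: for couplings `0 ≤ K' ≤ K` and every `A`,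
`Z_{K'}[A] · Z_K[∅] ≤ Z_K[A] · Z_{K'}[∅]` (`⟨σ_A⟩_{K'} ≤ ⟨σ_A⟩_K`; the tree's `wcurrentSum_mul_le_of_le`).
[cite: FriedliVelenik2017, Thm. 3.49 and Exercise 3.31] -/
theorem ecurrentSum_mul_le_of_le {K K' : G.edgeFinset → ℝ} (hK' : ∀ e, 0 ≤ K' e) (hle : ∀ e, K' e ≤ K e)
    (A : Finset V) : ecurrentSum K' A * ecurrentSum K ∅ ≤ ecurrentSum K A * ecurrentSum K' ∅ := by
  have hK : ∀ e, 0 ≤ K e := fun e => (hK' e).trans (hle e)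
  rw [ecurrentSum_eq_ofReal hK', ecurrentSum_eq_ofReal hK, ecurrentSum_eq_ofReal hK,
    ecurrentSum_eq_ofReal hK', ← ENNReal.ofReal_mul (wcurrentSum_nonneg hK' A),
    ← ENNReal.ofReal_mul (wcurrentSum_nonneg hK A)]
  exact ENNReal.ofReal_le_ofReal (wcurrentSum_mul_le_of_le hK' hle A)

namespace Current

variable {K : G.edgeFinset → ℝ} {rk : G.edgeFinset → ℕ} {n : Current G} {Y : Finset V}

/-! ### Switched-off couplings are dominated -/

/-- `K off D ≤ K` for `K ≥ 0`. [folklore] -/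
theorem koff_le (hK : ∀ e, 0 ≤ K e) (D : Finset G.edgeFinset) : ∀ e, koff K D e ≤ K e := fun e => by
  unfold koff; split_ifs; exacts [hK e, le_rfl]

/-- **Griffiths for the switched-off couplings** (Aizenman 1982, Lemma 9.3, by GKS II):
`Z_{K off D}[A] · Z_K[∅] ≤ Z_K[A] · Z_{K off D}[∅]`. [cite: AizenmanCMP1982, Lemma 9.3] -/
theorem ecurrentSum_koff_mul_le (hK : ∀ e, 0 ≤ K e) (D : Finset G.edgeFinset) (A : Finset V) :
    ecurrentSum (koff K D) A * ecurrentSum K ∅ ≤ ecurrentSum K A * ecurrentSum (koff K D) ∅ :=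
  ecurrentSum_mul_le_of_le (koff_nonneg hK D) (koff_le hK D) A

/-! ### The walk determines its cylinder, and conversely -/

/-- A current lies in the cylinder of its own walk. [folklore] -/
theorem inCyl_explore (n : Current G) (a : V) : InCyl (explore rk n Y a) n :=
  fun _ he => (pat_explore a he).symm

/-- **The walk of `n` equals the walk of `n₀` iff `n` lies in the cylinder of the walk of `n₀`**
(locality of the walk, Aizenman 1982, Lemma 9.1). [cite: AizenmanCMP1982, §9 Lemma 9.1] -/
theorem explore_eq_iff_inCyl (hrk : Function.Injective rk) {n₀ n : Current G} {a : V} :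
    explore rk n Y a = explore rk n₀ Y a ↔ InCyl (explore rk n₀ Y a) n := by
  constructor
  · intro h; rw [← h]; exact inCyl_explore n a
  · intro h
    exact explore_congr hrk fun e he => by rw [h e he, pat_explore a he]

open scoped Classical in
/-- The final states of walks from `a` with target `Y` that end at `u`. [folklore] -/
def finalStates (rk : G.edgeFinset → ℕ) (Y : Finset V) (a u : V) : Finset (XState G) :=
  univ.filter fun δ => δ.pos = u ∧ ∃ n₀ : Current G, δ = explore rk n₀ Y a

/-- Membership in `finalStates`. [folklore] -/
theorem mem_finalStates_iff {a u : V} {δ : XState G} :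
    δ ∈ finalStates rk Y a u ↔ δ.pos = u ∧ ∃ n₀ : Current G, δ = explore rk n₀ Y a := by
  classical
  unfold finalStates
  rw [mem_filter]
  simp

/-- **Partition by the final state**: `∑_n g(n) 𝟙[(explore n).pos = u] = ∑_{δ ends at u} ∑_n g(n) 𝟙[n ∈ Cyl(δ)]`.
[cite: AizenmanCMP1982, Prop. 9.2 (summing over walks ω)] -/
theorem tsum_mul_indicator_pos_eq_sum (hrk : Function.Injective rk) (g : Current G → ℝ≥0∞) (a u : V) :
    ∑' n : Current G, g n * (if (explore rk n Y a).pos = u then 1 else 0) =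
      ∑ δ ∈ finalStates rk Y a u, ∑' n : Current G, g n * (if InCyl δ n then 1 else 0) := by
  classical
  rw [← Summable.tsum_finsetSum (fun _ _ => ENNReal.summable)]
  refine tsum_congr fun n => ?_
  rw [← Finset.mul_sum]
  congr 1
  have key : ∀ δ ∈ finalStates rk Y a u, (InCyl δ n ↔ explore rk n Y a = δ) := by
    intro δ hδ
    obtain ⟨-, n₀, rfl⟩ := mem_finalStates_iff.1 hδ
    exact (explore_eq_iff_inCyl hrk).symm
  by_cases hu : (explore rk n Y a).pos = u
  · rw [if_pos hu]
    have hmem : explore rk n Y a ∈ finalStates rk Y a u := mem_finalStates_iff.2 ⟨hu, n, rfl⟩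
    rw [Finset.sum_eq_single_of_mem _ hmem]
    · rw [if_pos (inCyl_explore n a)]
    · intro δ hδ hne
      rw [if_neg]
      intro hc
      exact hne ((key δ hδ).1 hc).symm
  · rw [if_neg hu]
    refine (Finset.sum_eq_zero fun δ hδ => ?_).symm
    rw [if_neg]
    intro hc
    have h := (key δ hδ).1 hc
    exact hu (h ▸ (mem_finalStates_iff.1 hδ).1)

/-- **The cylinder sums of a final state** (`tsum_sources_inCyl_eq` read on `finalStates`):
`∑ 1{∂n = A} w(n) 𝟙[n ∈ Cyl(δ)] = patSum(δ) · Z_{K off used(δ)}[A Δ {a} Δ {u}]` for `δ` ending at `u`.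
[cite: AizenmanCMP1982, Prop. 9.2, eq. (9.8) and Lemma 9.2] -/
theorem tsum_inCyl_of_mem_finalStates (hK : ∀ e, 0 ≤ K e) (hrk : Function.Injective rk) {a u : V}
    {δ : XState G} (hδ : δ ∈ finalStates rk Y a u) (A : Finset V) :
    ∑' n : Current G, (if n.sources = A then n.eweight K else 0) * (if InCyl δ n then 1 else 0) =
      patSum K δ * ecurrentSum (koff K δ.used) (A ∆ ({a} ∆ {u})) := by
  obtain ⟨hpos, n₀, hδ'⟩ := mem_finalStates_iff.1 hδ
  have h := tsum_sources_inCyl_eq hK hrk hδ' A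
  rw [hpos] at h
  rw [← h]
  refine tsum_congr fun n => ?_
  by_cases h1 : n.sources = A <;> by_cases h2 : InCyl δ n <;> simp [h1, h2]

/-! ### The chain rule, one passage point -/

/-- **The chain rule for backbones, one passage point** (Aizenman–Barsky–Fernández 1987, as invoked
by Aizenman–Duminil-Copin 2021, (6.11)/(6.13)), finite volume, current-sum form: for `K ≥ 0`, an
injective ranking, any target set `Y` and vertices `a, b, u`,
`(∑ 1{∂n = {a}Δ{b}} w(n) 𝟙[(explore rk n Y a).pos = u]) · Z[∅] ≤ Z[{a}Δ{u}] · Z[{u}Δ{b}]`, i.e.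
`P^{ab}[the walk from a with target Y ends at u] ≤ ⟨σ_aσ_u⟩⟨σ_uσ_b⟩/⟨σ_aσ_b⟩`.
[cite: AizenmanDuminilCopinAnnals2021, arXiv:1912.07973 §6.2, proof of Lemma 6.7, (6.11) ("the chain rule for backbones [AizBarFer87]") (p. 25)] -/
theorem tsum_backbonePass_mul_le (hK : ∀ e, 0 ≤ K e) (hrk : Function.Injective rk) (Y : Finset V)
    (a b u : V) :
    (∑' n : Current G, (if n.sources = {a} ∆ {b} then n.eweight K else 0) *
        (if (explore rk n Y a).pos = u then 1 else 0)) * ecurrentSum K ∅ ≤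
      ecurrentSum K ({a} ∆ {u}) * ecurrentSum K ({u} ∆ {b}) := by
  classical
  rw [tsum_mul_indicator_pos_eq_sum hrk]
  have hab : (({a} : Finset V) ∆ {b}) ∆ ({a} ∆ {u}) = {u} ∆ {b} := by
    rw [symmDiff_symmDiff_symmDiff_left, symmDiff_comm]
  have hau : (({a} : Finset V) ∆ {u}) ∆ ({a} ∆ {u}) = ∅ := by
    rw [symmDiff_self, Finset.bot_eq_empty]
  calc (∑ δ ∈ finalStates rk Y a u, ∑' n : Current G,
          (if n.sources = {a} ∆ {b} then n.eweight K else 0) * (if InCyl δ n then 1 else 0)) * ecurrentSum K ∅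
      = ∑ δ ∈ finalStates rk Y a u, patSum K δ * (ecurrentSum (koff K δ.used) ({u} ∆ {b}) * ecurrentSum K ∅) := by
        rw [Finset.sum_mul]
        refine Finset.sum_congr rfl fun δ hδ => ?_
        rw [tsum_inCyl_of_mem_finalStates hK hrk hδ, hab, mul_assoc]
    _ ≤ ∑ δ ∈ finalStates rk Y a u, patSum K δ * (ecurrentSum K ({u} ∆ {b}) * ecurrentSum (koff K δ.used) ∅) :=
        Finset.sum_le_sum fun δ _ => mul_le_mul' le_rfl (ecurrentSum_koff_mul_le hK _ _)
    _ = (∑ δ ∈ finalStates rk Y a u, patSum K δ * ecurrentSum (koff K δ.used) ∅) * ecurrentSum K ({u} ∆ {b}) := by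
        rw [Finset.sum_mul]
        refine Finset.sum_congr rfl fun δ _ => ?_
        ring
    _ = (∑ δ ∈ finalStates rk Y a u, ∑' n : Current G,
          (if n.sources = {a} ∆ {u} then n.eweight K else 0) * (if InCyl δ n then 1 else 0)) *
          ecurrentSum K ({u} ∆ {b}) := by
        congr 1
        refine Finset.sum_congr rfl fun δ hδ => ?_
        rw [tsum_inCyl_of_mem_finalStates hK hrk hδ, hau]
    _ = (∑' n : Current G, (if n.sources = {a} ∆ {u} then n.eweight K else 0) *
          (if (explore rk n Y a).pos = u then 1 else 0)) * ecurrentSum K ({u} ∆ {b}) := by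
        rw [← tsum_mul_indicator_pos_eq_sum hrk]
    _ ≤ ecurrentSum K ({a} ∆ {u}) * ecurrentSum K ({u} ∆ {b}) := by
        refine mul_le_mul' ?_ le_rfl
        unfold ecurrentSum
        refine ENNReal.tsum_le_tsum fun n => ?_
        calc (if n.sources = {a} ∆ {u} then n.eweight K else 0) * (if (explore rk n Y a).pos = u then (1 : ℝ≥0∞) else 0)
            ≤ (if n.sources = {a} ∆ {u} then n.eweight K else 0) * 1 :=
              mul_le_mul' le_rfl (by split_ifs <;> simp)
          _ = _ := mul_one _

/-- **The chain rule summed over a set of passage points** (the printed sums over `v ∈ ∂Λ_R` in (6.11),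
(6.13)): `(∑ 1{∂n = {a}Δ{b}} w(n) 𝟙[(explore rk n Y a).pos ∈ S]) · Z[∅] ≤ ∑_{u ∈ S} Z[{a}Δ{u}] Z[{u}Δ{b}]`.
[cite: AizenmanDuminilCopinAnnals2021, arXiv:1912.07973 §6.2, proof of Lemma 6.7, (6.11), (6.13) (p. 25)] -/
theorem tsum_backbonePass_mem_mul_le (hK : ∀ e, 0 ≤ K e) (hrk : Function.Injective rk) (Y : Finset V)
    (a b : V) (S : Finset V) :
    (∑' n : Current G, (if n.sources = {a} ∆ {b} then n.eweight K else 0) *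
        (if (explore rk n Y a).pos ∈ S then 1 else 0)) * ecurrentSum K ∅ ≤
      ∑ u ∈ S, ecurrentSum K ({a} ∆ {u}) * ecurrentSum K ({u} ∆ {b}) := by
  classical
  have hind : ∀ n : Current G, (if (explore rk n Y a).pos ∈ S then (1 : ℝ≥0∞) else 0) =
      ∑ u ∈ S, (if (explore rk n Y a).pos = u then 1 else 0) := by
    intro n
    by_cases h : (explore rk n Y a).pos ∈ S
    · rw [if_pos h, Finset.sum_eq_single_of_mem _ h (fun u _ hu => if_neg (Ne.symm hu)), if_pos rfl]
    · rw [if_neg h]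
      refine (Finset.sum_eq_zero fun u hu => if_neg ?_).symm
      rintro rfl
      exact h hu
  simp_rw [hind, Finset.mul_sum]
  rw [Summable.tsum_finsetSum (fun _ _ => ENNReal.summable), Finset.sum_mul]
  exact Finset.sum_le_sum fun u _ => tsum_backbonePass_mul_le hK hrk Y a b u

/-! ### First passage: from the visited set to the walk with enlarged target -/

/-- The visited set grows by the current site at each step. [folklore] -/
theorem vis_exploreAt_succ (a : V) (k : ℕ) :
    (exploreAt rk n Y a (k + 1)).vis = insert (exploreAt rk n Y a (k + 1)).pos (exploreAt rk n Y a k).vis := by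
  rw [exploreAt_succ]
  set s := exploreAt rk n Y a k with hs
  have hpos : s.pos ∈ s.vis := (pos_mem_vis_exploreAt (rk := rk) (n := n) (Y := Y) a k).1
  rcases xstep_cases (rk := rk) (n := n) (Y := Y) s with ⟨-, h⟩ | ⟨-, -, h⟩ | ⟨-, -, hA, h⟩ | ⟨-, -, -, h⟩ <;>
    rw [h]
  · rw [Finset.insert_eq_of_mem hpos]
  · exact (Finset.insert_eq_of_mem hpos).symm
  · rfl
  · exact (Finset.insert_eq_of_mem hpos).symm

/-- **The visited sites are the past positions**: `v ∈ vis_k ↔ ∃ j ≤ k, pos_j = v`. [folklore] -/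
theorem mem_vis_exploreAt_iff (a : V) (k : ℕ) {v : V} :
    v ∈ (exploreAt rk n Y a k).vis ↔ ∃ j, j ≤ k ∧ (exploreAt rk n Y a j).pos = v := by
  induction k with
  | zero =>
    simp only [exploreAt_zero, xinit, Finset.mem_singleton, Nat.le_zero]
    constructor
    · intro h; exact ⟨0, rfl, by rw [exploreAt_zero]; exact h.symm⟩
    · rintro ⟨j, rfl, h⟩; rw [exploreAt_zero] at h; exact h.symm
  | succ k ih =>
    rw [vis_exploreAt_succ, Finset.mem_insert, ih]
    constructor
    · rintro (h | ⟨j, hj, h⟩)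
      · exact ⟨k + 1, le_rfl, h.symm⟩
      · exact ⟨j, Nat.le_succ_of_le hj, h⟩
    · rintro ⟨j, hj, h⟩
      rcases Nat.lt_succ_iff_lt_or_eq.1 (Nat.lt_succ_of_le hj) with hj' | rfl
      · exact Or.inr ⟨j, Nat.lt_succ_iff.1 hj', h⟩
      · exact Or.inl h.symm

/-- **At a target site the walk stays put**: if `pos_k ∈ Y` then `pos_{k'} = pos_k` for all `k' ≥ k`.
[folklore] -/
theorem pos_exploreAt_eq_of_mem_target (a : V) {k : ℕ} (hk : (exploreAt rk n Y a k).pos ∈ Y) {k' : ℕ}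
    (hk' : k ≤ k') : (exploreAt rk n Y a k').pos = (exploreAt rk n Y a k).pos := by
  induction hk' with
  | refl => rfl
  | step hle ih =>
    rw [exploreAt_succ]
    set s := exploreAt rk n Y a _ with hs
    have hsY : s.pos ∈ Y := by rw [ih]; exact hk
    rcases xstep_cases (rk := rk) (n := n) (Y := Y) s with ⟨-, h⟩ | ⟨-, -, h⟩ | ⟨-, hY, -, -⟩ | ⟨-, hY, -, -⟩
    · rw [h]; exact ih
    · rw [h]; exact ih
    · exact absurd hsY hY
    · exact absurd hsY hY

/-- **Changing the target up to a given time**: if before time `k` the walk with target `Y` is in `Y`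
exactly when it is in `Y'`, the two walks agree at time `k`. [folklore] -/
theorem exploreAt_target_congr_of_lt {Y' : Finset V} (a : V) {k : ℕ}
    (h : ∀ j, j < k → ((exploreAt rk n Y a j).pos ∈ Y ↔ (exploreAt rk n Y a j).pos ∈ Y')) :
    exploreAt rk n Y' a k = exploreAt rk n Y a k := by
  induction k with
  | zero => rfl
  | succ k ih =>
    rw [exploreAt_succ, exploreAt_succ, ih fun j hj => h j (Nat.lt_succ_of_lt hj)]
    exact (xstep_target_congr _ (h k (Nat.lt_succ_self k))).symm

/-- **First passage** (the comparison behind reading "`Γ` visits `S`" on the walk with enlarged target):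
if the walk from `a` with target `Y` visits a site of `S`, then the walk with target `Y ∪ S` ends at a
site of `S`. [cite: AizenmanDuminilCopinAnnals2021, arXiv:1912.07973 §6.2, proof of Lemma 6.7 (the event "Γ(n_i) crosses Ann(M,R)") (p. 25)] -/
theorem pos_explore_union_mem_of_mem_vis (a : V) {S : Finset V} {v : V} (hvS : v ∈ S)
    (hv : v ∈ (explore rk n Y a).vis) : (explore rk n (Y ∪ S) a).pos ∈ S := by
  classical
  set N := Fintype.card G.edgeFinset + 1 with hN
  -- the time `j₀ ≤ N` of a visit of `S ∪ Y`, and the first such time `k₀`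
  rw [explore_eq_exploreAt] at hv
  obtain ⟨j₀, hj₀N, hj₀⟩ := (mem_vis_exploreAt_iff a N).1 hv
  have hex : ∃ k, (exploreAt rk n Y a k).pos ∈ Y ∪ S := ⟨j₀, by rw [hj₀]; exact mem_union_right _ hvS⟩
  set k₀ := Nat.find hex with hk₀
  have hk₀spec : (exploreAt rk n Y a k₀).pos ∈ Y ∪ S := Nat.find_spec hex
  have hk₀min : ∀ j, j < k₀ → (exploreAt rk n Y a j).pos ∉ Y ∪ S := fun j hj => Nat.find_min hex hj
  have hk₀j₀ : k₀ ≤ j₀ := Nat.find_min' hex (by rw [hj₀]; exact mem_union_right _ hvS)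
  -- up to `k₀` the two walks agree
  have hagree : exploreAt rk n (Y ∪ S) a k₀ = exploreAt rk n Y a k₀ := by
    refine exploreAt_target_congr_of_lt a fun j hj => ?_
    have h1 := hk₀min j hj
    rw [mem_union, not_or] at h1
    exact ⟨fun h => absurd h h1.1, fun h => by rw [mem_union] at h; rcases h with h | h; exacts [h, absurd h h1.2]⟩
  -- the site `v₀` reached at `k₀` lies in `S`
  set v₀ := (exploreAt rk n Y a k₀).pos with hv₀
  have hv₀S : v₀ ∈ S := by
    by_contra hnot
    have hv₀Y : v₀ ∈ Y := by
      rcases mem_union.1 hk₀spec with h | h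
      · exact h
      · exact absurd h hnot
    -- then the `Y`-walk stays at `v₀ ∉ S` from `k₀` on, and never visits `v ∈ S`
    have hstay := pos_exploreAt_eq_of_mem_target (rk := rk) (n := n) (Y := Y) a (k := k₀) hv₀Y hk₀j₀
    rw [hj₀] at hstay
    apply hnot
    rw [hv₀, ← hstay]
    exact hvS
  -- the `(Y ∪ S)`-walk is at `v₀ ∈ Y ∪ S` at time `k₀`, hence stays there
  have hposk₀ : (exploreAt rk n (Y ∪ S) a k₀).pos = v₀ := by rw [hagree]
  have htarget : (exploreAt rk n (Y ∪ S) a k₀).pos ∈ Y ∪ S := by rw [hposk₀]; exact mem_union_right _ hv₀S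
  have hk₀N : k₀ ≤ N := hk₀j₀.trans hj₀N
  rw [explore_eq_exploreAt, pos_exploreAt_eq_of_mem_target a htarget hk₀N, hposk₀]
  exact hv₀S

/-- **The chain rule for the visited set** (Aizenman–Duminil-Copin 2021, (6.11)/(6.13):
"`P^{xy}[Γ(n_i) crosses Ann(M,R)] ≤ ∑_{v ∈ ∂Λ_R} ⟨σ_{x_i}σ_v⟩⟨σ_vσ_{u_i}⟩/⟨σ_{x_i}σ_{u_i}⟩`"), finite
volume, current-sum form: for `K ≥ 0`, an injective ranking, a target `Y`, vertices `a, b` and a set `S`,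
`(∑ 1{∂n = {a}Δ{b}} w(n) 𝟙[the Y-walk of n from a visits S]) · Z[∅] ≤ ∑_{u ∈ S} Z[{a}Δ{u}] Z[{u}Δ{b}]`
(with `Y = {b}` the walk is the backbone `Γ(n)` from `a` to `b`).
[cite: AizenmanDuminilCopinAnnals2021, arXiv:1912.07973 §6.2, proof of Lemma 6.7, (6.11), (6.13) (p. 25)] -/
theorem tsum_backboneVisits_mul_le (hK : ∀ e, 0 ≤ K e) (hrk : Function.Injective rk) (Y : Finset V)
    (a b : V) (S : Finset V) :
    (∑' n : Current G, (if n.sources = {a} ∆ {b} then n.eweight K else 0) *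
        (if ((explore rk n Y a).vis ∩ S).Nonempty then 1 else 0)) * ecurrentSum K ∅ ≤
      ∑ u ∈ S, ecurrentSum K ({a} ∆ {u}) * ecurrentSum K ({u} ∆ {b}) := by
  classical
  refine le_trans (mul_le_mul' (ENNReal.tsum_le_tsum fun n => mul_le_mul' le_rfl ?_) le_rfl)
    (tsum_backbonePass_mem_mul_le hK hrk (Y ∪ S) a b S)
  -- `𝟙[vis ∩ S ≠ ∅] ≤ 𝟙[(explore (Y ∪ S)).pos ∈ S]`
  split_ifs with h1 h2
  · exact le_rfl
  · exfalso
    obtain ⟨v, hv⟩ := h1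
    rw [Finset.mem_inter] at hv
    exact h2 (pos_explore_union_mem_of_mem_vis a hv.2 hv.1)
  · exact bot_le
  · exact le_rfl

end Current

end Literature.Probability.LatticeModels
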